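/-
Origin: expansion seat `planner-pub-hodgecm-pv07-g2-0`, handover #7b 2026-08-18T06:39:50Z (`HOME/pub-hodgecm-pv07-g2/lean/Pv07g2/DilationIntegral.lean`, md5 b9278d09, 229 lines);
landed by the gen-7 packager in gate run 25 as `HodgeCM/PerL34/LocalFactors/DilationIntegral.lean` (import ^import Pv07g2\.→import HodgeCM.PerL34.LocalFactors. ×2).
-/
/-
Copyright: HodgeCM publication cell (pub-hodgecm), DAG node N31g — the split unramified local factor in the
D4 dilation model, CLOSED FORM (prover lineage pv07, gen 2).  Released under the package licence.

# `I_v(φ⁰_v) = Σ_n q_v^{-3|n|/2} (χ'ν)(ϖ)ⁿ = (1 − q_v⁻³)/|1 − (χ'ν)(ϖ) q_v^{-3/2}|² > 0` in the dilation model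

Source under adjudication (NOT cited; this file PROVES its claim for the constructed datum): PerL v5, Lemma 4.2(b),
proof, tex l. 629–630 — "at split `v` the integral `∫_{L_{0,v}^×} ⟨ω_v(y)φ⁰_v, φ⁰_v⟩ χ'_{i,v}(y) d^×y =
∫ q_v^{-3|ord y|/2} ν_vχ'_{i,v}(y) d^×y` converges absolutely to a non-zero value since `Σ_n q_v^{-3|n|/2} < ∞`".

For the CONSTRUCTED split-place datum `splitIntegrand μV 0 ρ μG ν χ'` (pv07-g2 `DilationModel`: `G = F^×`,
`ω = ν ⊗ (unitary dilation on L²(F³))`, `φ⁰ = 1_{closedBall 0 ρ}`) over ANY non-archimedean local field `F`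
(non-trivially normed, ultrametric, proper), with `ν`, `χ'` unramified, `vol(closedBall 0 ρ) = 1` and
`vol^×(𝒪^×) = 1`, this file PROVES — no shell data, no `q`, no `ord` supplied by hand —
* `splitIntegrand_Ic_eq_tsum`: `I = Σ'_{n ∈ ℤ} (tOf q)^{|n|} ((χ'ν)(ϖ))ⁿ`, `q = [𝒪 : ϖ𝒪]` (`LocalModulus.resIndex`),
  for every uniformizer `ϖ` (`DilationOrd.IsUniformizer`, which EXISTS: `exists_isUniformizer`);
* `splitIntegrand_Ic_eq_closedForm`: `I = (1 − q⁻³)/normSq(1 − (χ'ν)(ϖ)·tOf q)` (l. 630 in full);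
* `splitIntegrand_I_pos_of_isUniformizer`, `splitIntegrand_I_pos_canonical`: `0 < I` with the canonical `d^×y`
  (`haarMeasure unitSphereCompacts`, `vol(𝒪^×) = 1`) — the "non-zero value" of l. 630, hypothesis-free;
* `Smoke.padic_Ic_closedForm`: `F = ℚ_p`, `ν = χ' = 1`: `I = (1 − p⁻³)/(1 − p^{-3/2})²`.
Assembly = pv10's landed `UnramifiedFactors.split_integral_eq_tsum / _closedForm / _re_pos` (general shell lemma)
fed with pv07-g2's kernel shell partition (`DilationOrd`) and shell values (`DilationResIndex`, with pv13-g3's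
`LocalModulus.resIndex`).  Nothing is cited; no hypothesis names PerL, QW8 or a 2001-programme claim.
Axioms = the standard trio.  Unit `pub-hodgecm-pv07-g2`, 2026-08-18.
-/
import Summits.HodgeConjecture.HodgeCM.PerL34.LocalFactors.DilationOrd
import Summits.HodgeConjecture.HodgeCM.PerL34.LocalFactors.PadicResIndex
import Summits.HodgeConjecture.HodgeCM.PerL34.UnramifiedFactors

/-! PORT of `HodgeCM/PerL34/LocalFactors/DilationIntegral.lean` (HodgeCMPerL run 82) — verbatim mechanical port; provenance in the PORT header line. -/

set_option autoImplicit false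

noncomputable section

open MeasureTheory MeasureTheory.Measure Set Metric TopologicalSpace
open scoped NNReal ENNReal Pointwise

namespace HodgeCM
namespace PerL34
namespace LocalFactors
namespace DilationModel

section Integral

variable {F : Type} [NontriviallyNormedField F] [IsUltrametricDist F] [ProperSpace F]

/-- pv10's `tParam q = (q√q)⁻¹` is pv13's `tOf q = q^{-3/2}` -/
theorem tParam_eq_tOf (q : ℕ) (hq : 0 < q) : UnramifiedFactors.tParam q = EulerProduct.tOf q :=
  UnramifiedFactors.tParam_eq_rpow hq

/-! ### The shells are compact open; `𝒪^×` normalises `d^×y` -/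

omit [IsUltrametricDist F] [ProperSpace F] in
/-- (Ported verbatim from the HodgeCMPerL package; no docstring in the source.) -/
theorem shell_eq_preimage_sphere (ϖ : Fˣ) (k : ℤ) :
    shell ϖ k = (Units.val : Fˣ → F) ⁻¹' sphere (0 : F) (‖(ϖ : F)‖ ^ k) := by
  ext y; rw [mem_preimage, mem_sphere_zero_iff_norm]; rfl

omit [IsUltrametricDist F] in
/-- (Ported verbatim from the HodgeCMPerL package; no docstring in the source.) -/
theorem isCompact_shell (ϖ : Fˣ) (k : ℤ) : IsCompact (shell ϖ k) := by
  rw [shell_eq_preimage_sphere]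
  refine Units.isEmbedding_val₀.isInducing.isCompact_preimage' (isCompact_sphere _ _) ?_
  intro y hy
  have hy0 : y ≠ 0 := norm_ne_zero_iff.mp (by
    rw [mem_sphere_zero_iff_norm.mp hy]; exact (zpow_pos (norm_units_pos ϖ) k).ne')
  exact ⟨Units.mk0 y hy0, rfl⟩

omit [ProperSpace F] in
/-- (Ported verbatim from the HodgeCMPerL package; no docstring in the source.) -/
theorem isOpen_shell (ϖ : Fˣ) (k : ℤ) : IsOpen (shell ϖ k) := by
  rw [shell_eq_preimage_sphere]
  exact (IsUltrametricDist.isOpen_sphere _ (zpow_pos (norm_units_pos ϖ) k).ne').preimage Units.continuous_val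

omit [IsUltrametricDist F] [ProperSpace F] in
/-- `shell ϖ 0 = 𝒪^× = {‖y‖ = 1}` does not depend on `ϖ` -/
theorem shell_zero_eq (ϖ : Fˣ) : shell ϖ 0 = {y : Fˣ | ‖(y : F)‖ = 1} := by
  ext y; rw [mem_shell_iff, zpow_zero]; rfl

/-- **`𝒪^× = {y ∈ F^× : ‖y‖ = 1}`** as a compact set with non-empty interior — the normalising set of `d^×y` -/
def unitSphereCompacts : PositiveCompacts Fˣ where
  carrier := {y : Fˣ | ‖(y : F)‖ = 1}
  isCompact' := by rw [← shell_zero_eq 1]; exact isCompact_shell 1 0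
  interior_nonempty' := by
    have ho : IsOpen {y : Fˣ | ‖(y : F)‖ = 1} := by rw [← shell_zero_eq 1]; exact isOpen_shell 1 0
    change (interior {y : Fˣ | ‖(y : F)‖ = 1}).Nonempty
    rw [ho.interior_eq]
    exact ⟨1, show ‖((1 : Fˣ) : F)‖ = 1 by rw [Units.val_one, norm_one]⟩

/-- (Ported verbatim from the HodgeCMPerL package; no docstring in the source.) -/
theorem coe_unitSphereCompacts :
    ((unitSphereCompacts (F := F) : PositiveCompacts Fˣ) : Set Fˣ) = {y : Fˣ | ‖(y : F)‖ = 1} := rfl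

attribute [local instance] unitsBorel borelSpace_units

/-- the canonical `d^×y`: `vol^×(𝒪^×) = 1`, i.e. `vol^×(shell ϖ 0) = 1` for every `ϖ` -/
theorem haarMeasure_unitSphereCompacts_shell_zero (ϖ : Fˣ) :
    haarMeasure (unitSphereCompacts (F := F)) (shell ϖ 0) = 1 := by
  rw [shell_zero_eq]; exact haarMeasure_self

/-- instances found (recorded) -/
example : (haarMeasure (unitSphereCompacts (F := F))).IsHaarMeasure := inferInstance
example : (haarMeasure (unitSphereCompacts (F := F))).Regular := inferInstance

/-! ### The closed form -/

omit [IsUltrametricDist F] [ProperSpace F] in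
/-- (Ported verbatim from the HodgeCMPerL package; no docstring in the source.) -/
theorem norm_chi_mul_nu (ν χ' : Fˣ →* Circle) (y : Fˣ) : ‖(χ' y : ℂ) * (ν y : ℂ)‖ = 1 := by
  rw [norm_mul, Circle.norm_coe, Circle.norm_coe, mul_one]

variable [MeasurableSpace (Fin 3 → F)] [BorelSpace (Fin 3 → F)] (μV : Measure (Fin 3 → F)) [μV.IsAddHaarMeasure]
  (ρ : ℝ) (ν : Fˣ →* Circle) (μG : Measure Fˣ) [μG.IsHaarMeasure] [μG.Regular] (χ' : Fˣ →* Circle)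

/-- shell values with pv10's parameter `tParam` (= `DilationResIndex.splitIntegrand_f_eqOn_shell_resIndex`) -/
theorem splitIntegrand_f_eqOn_shell_tParam (ϖ : Fˣ) (hϖ : ‖(ϖ : F)‖ < 1)
    (hν : ∀ u : Fˣ, ‖(u : F)‖ = 1 → ν u = 1) (hχ : ∀ u : Fˣ, ‖(u : F)‖ = 1 → χ' u = 1)
    (hvol : μV.real (closedBall (0 : Fin 3 → F) ρ) = 1) (k : ℤ) :
    EqOn (splitIntegrand μV 0 ρ μG ν χ').f
      (fun _ => (UnramifiedFactors.tParam (LocalModulus.resIndex ϖ) : ℂ) ^ k.natAbs *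
        ((χ' ϖ : ℂ) * (ν ϖ : ℂ)) ^ k) (shell ϖ k) := by
  rw [tParam_eq_tOf _ (lt_of_lt_of_le zero_lt_two (two_le_resIndex_of_norm_lt_one ϖ hϖ))]
  exact splitIntegrand_f_eqOn_shell_resIndex μV ρ ν μG χ' ϖ hϖ hν hχ hvol k

/-- `I` of the constructed datum is the integral over `F^×` against `μG` (definitional) -/
theorem splitIntegrand_Ic_eq_integral (x₀ : Fin 3 → F) (r : ℝ) :
    (splitIntegrand μV x₀ r μG ν χ').Ic = ∫ y, (splitIntegrand μV x₀ r μG ν χ').f y ∂μG := rfl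

/-- **Tex l. 630, first equality, in the D4 model (kernel).**  `I_v(φ⁰_v) = Σ'_{n∈ℤ} (tOf q)^{|n|}·((χ'ν)(ϖ))ⁿ`,
`q = [𝒪 : ϖ𝒪]`, for every uniformizer `ϖ`, `ν`, `χ'` unramified, `vol(B) = 1`, `vol^×(𝒪^×) = 1`. -/
theorem splitIntegrand_Ic_eq_tsum (ϖ : Fˣ) (hϖ : IsUniformizer ϖ)
    (hν : ∀ u : Fˣ, ‖(u : F)‖ = 1 → ν u = 1) (hχ : ∀ u : Fˣ, ‖(u : F)‖ = 1 → χ' u = 1)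
    (hvol : μV.real (closedBall (0 : Fin 3 → F) ρ) = 1) (hvolG : μG (shell ϖ 0) = 1) :
    (splitIntegrand μV 0 ρ μG ν χ').Ic =
      ∑' n : ℤ, ((EulerProduct.tOf (LocalModulus.resIndex ϖ) : ℝ) : ℂ) ^ n.natAbs *
        ((χ' ϖ : ℂ) * (ν ϖ : ℂ)) ^ n := by
  have hq2 := two_le_resIndex_of_norm_lt_one ϖ hϖ.1
  have h := UnramifiedFactors.split_integral_eq_tsum μG (shell ϖ) (measurableSet_shell ϖ)
    (pairwise_disjoint_shell ϖ hϖ.1) hϖ.iUnion_shell (fun n => by rw [measure_shell_eq μG ϖ n]; exact hvolG)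
    hq2 (norm_chi_mul_nu ν χ' ϖ) _ (splitIntegrand_f_eqOn_shell_tParam μV ρ ν μG χ' ϖ hϖ.1 hν hχ hvol)
  rw [tParam_eq_tOf _ (by omega)] at h
  exact h

/-- **Tex l. 630 in full, in the D4 model (kernel).**
`I_v(φ⁰_v) = (1 − q⁻³) / normSq (1 − (χ'ν)(ϖ)·q^{-3/2})`. -/
theorem splitIntegrand_Ic_eq_closedForm (ϖ : Fˣ) (hϖ : IsUniformizer ϖ)
    (hν : ∀ u : Fˣ, ‖(u : F)‖ = 1 → ν u = 1) (hχ : ∀ u : Fˣ, ‖(u : F)‖ = 1 → χ' u = 1)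
    (hvol : μV.real (closedBall (0 : Fin 3 → F) ρ) = 1) (hvolG : μG (shell ϖ 0) = 1) :
    (splitIntegrand μV 0 ρ μG ν χ').Ic =
      (((1 - (((LocalModulus.resIndex ϖ : ℕ) : ℝ) ^ 3)⁻¹) /
          Complex.normSq (1 - ((χ' ϖ : ℂ) * (ν ϖ : ℂ)) *
            (EulerProduct.tOf (LocalModulus.resIndex ϖ) : ℂ)) : ℝ) : ℂ) := by
  have hq2 := two_le_resIndex_of_norm_lt_one ϖ hϖ.1
  have h := UnramifiedFactors.split_integral_eq_closedForm μG (shell ϖ) (measurableSet_shell ϖ)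
    (pairwise_disjoint_shell ϖ hϖ.1) hϖ.iUnion_shell (fun n => by rw [measure_shell_eq μG ϖ n]; exact hvolG)
    hq2 (norm_chi_mul_nu ν χ' ϖ) _ (splitIntegrand_f_eqOn_shell_tParam μV ρ ν μG χ' ϖ hϖ.1 hν hχ hvol)
  rw [tParam_eq_tOf _ (by omega)] at h
  exact h

/-- **"converges … to a non-zero value" (l. 630), in the D4 model (kernel)**: `0 < I_v(φ⁰_v)` and
`Im I_v(φ⁰_v) = 0`. -/
theorem splitIntegrand_I_pos_of_isUniformizer (ϖ : Fˣ) (hϖ : IsUniformizer ϖ)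
    (hν : ∀ u : Fˣ, ‖(u : F)‖ = 1 → ν u = 1) (hχ : ∀ u : Fˣ, ‖(u : F)‖ = 1 → χ' u = 1)
    (hvol : μV.real (closedBall (0 : Fin 3 → F) ρ) = 1) (hvolG : μG (shell ϖ 0) = 1) :
    0 < (splitIntegrand μV 0 ρ μG ν χ').I ∧ (splitIntegrand μV 0 ρ μG ν χ').Ic.im = 0 := by
  have hq2 := two_le_resIndex_of_norm_lt_one ϖ hϖ.1
  exact UnramifiedFactors.split_integral_re_pos μG (shell ϖ) (measurableSet_shell ϖ)
    (pairwise_disjoint_shell ϖ hϖ.1) hϖ.iUnion_shell (fun n => by rw [measure_shell_eq μG ϖ n]; exact hvolG)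
    hq2 (norm_chi_mul_nu ν χ' ϖ) _ (splitIntegrand_f_eqOn_shell_tParam μV ρ ν μG χ' ϖ hϖ.1 hν hχ hvol)

omit μG

/-- **N31g, split unramified place, HYPOTHESIS-FREE in the D4 model**: for every non-archimedean local field `F`,
every unramified unitary `ν`, `χ'`, `φ⁰ = 1_B` with `vol(B) = 1`, and the canonical `d^×y` (`vol^×(𝒪^×) = 1`),
the local factor of the constructed datum is `> 0`.  (Uniformizer, `ord`, shells, `q` are all PRODUCED.) -/
theorem splitIntegrand_I_pos_canonical
    (hν : ∀ u : Fˣ, ‖(u : F)‖ = 1 → ν u = 1) (hχ : ∀ u : Fˣ, ‖(u : F)‖ = 1 → χ' u = 1)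
    (hvol : μV.real (closedBall (0 : Fin 3 → F) ρ) = 1) :
    0 < (splitIntegrand μV 0 ρ (haarMeasure (unitSphereCompacts (F := F))) ν χ').I := by
  obtain ⟨ϖ, hϖ⟩ := exists_isUniformizer (F := F)
  exact (splitIntegrand_I_pos_of_isUniformizer μV ρ ν (haarMeasure unitSphereCompacts) χ' ϖ hϖ hν hχ hvol
    (haarMeasure_unitSphereCompacts_shell_zero ϖ)).1

/-- … together with its closed form for SOME uniformizer (the value does not depend on the choice). -/
theorem splitIntegrand_Ic_canonical_exists
    (hν : ∀ u : Fˣ, ‖(u : F)‖ = 1 → ν u = 1) (hχ : ∀ u : Fˣ, ‖(u : F)‖ = 1 → χ' u = 1)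
    (hvol : μV.real (closedBall (0 : Fin 3 → F) ρ) = 1) :
    ∃ ϖ : Fˣ, IsUniformizer ϖ ∧
      (splitIntegrand μV 0 ρ (haarMeasure (unitSphereCompacts (F := F))) ν χ').Ic =
        ∑' n : ℤ, ((EulerProduct.tOf (LocalModulus.resIndex ϖ) : ℝ) : ℂ) ^ n.natAbs *
          ((χ' ϖ : ℂ) * (ν ϖ : ℂ)) ^ n := by
  obtain ⟨ϖ, hϖ⟩ := exists_isUniformizer (F := F)
  exact ⟨ϖ, hϖ, splitIntegrand_Ic_eq_tsum μV ρ ν (haarMeasure unitSphereCompacts) χ' ϖ hϖ hν hχ hvol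
    (haarMeasure_unitSphereCompacts_shell_zero ϖ)⟩

end Integral

/-! ### Smoke: `F = ℚ_p`, `ν = χ' = 1` — `I = (1 − p⁻³)/(1 − p^{-3/2})²` -/

namespace Smoke

variable (p : ℕ) [hp : Fact p.Prime]

/-- `p` is a uniformizer of `ℚ_p` in the norm sense: `‖x‖_p ∈ p^ℤ` (Mathlib `Padic.norm_eq_zpow_neg_valuation`) -/
theorem isUniformizer_varpi : IsUniformizer (varpi p) := by
  refine ⟨norm_varpi_lt_one p, fun y => ⟨(y : ℚ_[p]).valuation, ?_⟩⟩
  rw [varpi_val, Padic.norm_p, Padic.norm_eq_zpow_neg_valuation y.ne_zero, inv_zpow']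

attribute [local instance] unitsBorel borelSpace_units

variable [MeasurableSpace ℚ_[p]] [BorelSpace ℚ_[p]]

/-- **Smoke (l. 630 at `F = ℚ_p`, `ν = χ' = 1`)**: `I = (1 − p⁻³) / (1 − p^{-3/2})²`, and `0 < I`. -/
theorem padic_Ic_closedForm :
    (splitIntegrand (muV p) 0 1 (haarMeasure (unitSphereCompacts (F := ℚ_[p]))) 1 1).Ic =
        (((1 - ((p : ℝ) ^ 3)⁻¹) / (1 - EulerProduct.tOf p) ^ 2 : ℝ) : ℂ) ∧
      0 < (splitIntegrand (muV p) 0 1 (haarMeasure (unitSphereCompacts (F := ℚ_[p]))) 1 1).I := by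
  refine ⟨?_, splitIntegrand_I_pos_canonical (muV p) 1 1 1 (fun _ _ => rfl) (fun _ _ => rfl)
    (muV_real_unitBox p)⟩
  have ha : (((1 : ℚ_[p]ˣ →* Circle) (varpi p) : Circle) : ℂ) = 1 := by
    rw [MonoidHom.one_apply, Circle.coe_one]
  have hn : Complex.normSq (1 - (EulerProduct.tOf p : ℂ)) = (1 - EulerProduct.tOf p) ^ 2 := by
    rw [← Complex.ofReal_one, ← Complex.ofReal_sub, Complex.normSq_ofReal, sq]
  rw [splitIntegrand_Ic_eq_closedForm (muV p) 1 1 (haarMeasure unitSphereCompacts) 1 (varpi p)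
    (isUniformizer_varpi p) (fun _ _ => rfl) (fun _ _ => rfl) (muV_real_unitBox p)
    (haarMeasure_unitSphereCompacts_shell_zero (varpi p)), resIndex_padic, ha, one_mul, one_mul, hn]

end Smoke

end DilationModel
end LocalFactors
end PerL34
end HodgeCM

end
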